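import Literature.Topology.FourManifolds.LinkKhComplex
import Literature.Topology.FourManifolds.LeeRasmussenLabProofs
import Literature.Topology.FourManifolds.LeeRasmussenBasisProofs
import HarnessLib

/-!
# Lee's canonical enhanced states of a link Gauss diagram (link tower, layer D2c)

Fourth file of the link tower `LinkGaussDiagrams` (D1: `LinkGaussDiagram`, `ofGaussDiagram`,
`Arc = Fin (2n) ⊕ Fin free`, `arcOut`, `arcIn`, `unknots`, Morse moves) → `LinkKhResolutions`
(D2a: `State`, `isSeifert`, `stateGraph`, `circleOf`, `IsMergeAt`, `IsSplitAt`, `arcEquiv`,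
`stateGraphIso`) → `LinkKhComplex` (D2b: `EnhancedState`, `homDegree`, `incidence`, `khovanovD`,
`leeD`, `leeCycles`, `enhancedStateEquiv`, `degStatesEquiv`) → **this file**, which ports the
knot tower's `LeeRasmussenLabProofs` (`altLabel`, `seifertState`, `leeState`,
`homDegree_leeState`) and the cycle property of Lee's canonical generators
(`RasmussenSliceCanonicalProofs.leeCoord_symm_single_mem_leeCycles`, through the Lee monomials
of `LeeRasmussenBasisProofs.leeBasisMat`) to Gauss diagrams of oriented LINKS (census of crux
`ZseThesis`, stmt-SmoothPoincare4-0364, debt (D2)).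

## Conventions

* **Checkerboard colourings** (`IsCheckerboard c`, `c : Fin (2n) → Bool`): the colour changes at
  every marked point along the traversal (`c (next p) = !c p`) and the two ends of every chord
  have opposite colours (`c (underPos i) = !c (overPos i)`). On a knot diagram this is Gauss
  parity: `p ↦ [p even]` is a checkerboard colouring of `ofGaussDiagram G` as soon as
  `overPos i ≢ underPos i (mod 2)` (`isCheckerboard_ofGaussDiagram`; `next = finRotate`, and the
  wrap-around `2n - 1 → 0` changes parity because `2n` is even). For a diagram of a link in `ℝ³`
  the colour "Lee label of the Seifert circle through the arc leaving `p`" is a checkerboard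
  colouring (Rasmussen (2010), Lemma 2.4, Cor. 2.5: Seifert circles sharing a crossing carry
  different labels); this file does not need realisability.
* **Lee's canonical states** `leeState hc t u` (`hc : L.IsCheckerboard c`, a global flip
  `t : Bool`, free-circle labels `u : Fin free → Bool`): the Seifert state `seifertState` (all
  smoothings Seifert's, homological degree `0`) with the labelling
  `inl q ↦ bif c q then t else !t` — EXACTLY the knot convention `altLabel t q = if q even then t
  else !t` read through `arcEquiv` (`arcOut p = inl p ↦ p`), so that
  `enhancedStateEquiv G hG (leeState _ t Fin.elim0) = G.leeState hpar t` with the SAME `t`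
  (`enhancedStateEquiv_leeState`) — and `inr j ↦ u j`. Labels are read in Lee's basis
  `𝐚 = X + 1 ↔ false`, `𝐛 = X - 1 ↔ true` as in the knot tower; `(c, t)` and `(!c, !t)` give the
  same state. These are the canonical generators `𝔰_o` of the orientations `o` of the link whose
  oriented resolution is the Seifert state of `L` (among them the given orientation and its
  global reverse); the generators of the other orientations are those of the reoriented diagrams.
* **Lee monomials** (`leeMonomial k s`): the chain `Σ_λ (-1)^{pairCount σ λ ℓ} · (σ, λ)` of the
  enhanced state `s = (σ, ℓ)`, i.e. the monomial `⊗_C (X ± 1)` in `𝐚`, `𝐛` expanded in the basis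
  of enhanced states (`pairCount` = number of circles labelled `(1, 𝐛)`, verbatim
  `GaussDiagram.pairCount`); on `ofGaussDiagram G` it is the column `G.leeBasis k (Pi.single s 1)`
  of `leeBasisMat`, i.e. `2 ^ #circles • (G.leeCoord k).symm (Pi.single s 1)`, the canonical
  generator of `RasmussenSliceCanonicalProofs` (`leeMonomial_enhancedStateEquiv_symm`,
  `funCongrLeft_leeCoord_symm_single`).

## Main result: the canonical states are Lee cycles

`khovanovD_leeMonomial_eq_zero`: if an enhanced state `s` has, at every `0`-smoothed chord `i`,
different labels on the two local strands `arcIn (overPos i)`, `arcOut (overPos i)` (no free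
chord), then `d (leeMonomial k s) = 0` for Lee's differential `khovanovD ℚ 0 1 k k'`. Proof
(the shortest route, avoiding the conjugated differential `leeDiffMat` of the knot tower): every
edge out of `σ = s.state` is then a merge of two circles `C_a ∋ a`, `C_b ∋ b` with
`ℓ(C_a) ≠ ℓ(C_b)`; the involution "flip `λ` on `C_a ∪ C_b`" of the enhanced states over `σ`
preserves the Lee incidence number into any fixed target (`m(1 ⊗ 1) = m(X ⊗ X) = 1`,
`m(1 ⊗ X) = m(X ⊗ 1) = X` at `(h, t) = (0, 1)`, and the merged circle `C_a ∪ C_b` of the target is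
untouched off itself — this uses only the monotonicity `σ`-circle ⊆ `σ[i ↦ 1]`-circle of a merge,
`IsMergeAt.circleOf_update_eq`) and reverses the sign `(-1)^{pairCount}` (exactly one of `C_a`,
`C_b` is labelled `𝐛`), so the matrix coefficient `Σ_λ ⟨d(σ, λ), s'⟩ (-1)^{pairCount σ λ ℓ}`
vanishes (`Finset.sum_involution`). This is `m(𝐚 ⊗ 𝐛) = 0` of Lee (2005), §4; Rasmussen (2010),
§2.3. Hence `leeMonomial 0 (leeState hc t u) ∈ L.leeCycles` (`leeMonomial_leeState_mem_leeCycles`).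

## Also here

`seifertState` and its weight `n₋` (`homDegree_leeState = 0`), `isMergeAt_seifertState` (every
edge out of the Seifert state of a checkerboard-colourable diagram is a merge), the flip analysis
`adj_of_eq_off`, `circleOf_eq_of_atChord`, `IsMergeAt.circleOf_update_eq` for arbitrary link
diagrams, and sanity: on `unknots k` every `u` gives a canonical state and `u ↦ leeState _ t u` is
a bijection onto the `2 ^ k` enhanced states (`leeState_unknots_bijective`); the Hopf link is
checkerboard (`isCheckerboard_hopfLink`, `decide`). Not here: the filtration degree `qMin` of
the canonical cycles (`writhe - #circles`; next layer, with `s_min/s_max`), Lee's `2^m` theorem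
for links, and the tracking of `leeMonomial` under the Morse moves.

## References

* E. S. Lee, *An endomorphism of the Khovanov invariant*, Adv. Math. 197 (2005) 554–586, §4
  (the basis `𝐚`, `𝐛`; §4.4 canonical generators), Thm. 4.2. [cite: Lee2005, §4]
* J. Rasmussen, *Khovanov homology and the slice genus*, Invent. Math. 182 (2010) 419–447, §2.3
  (canonical generators `𝔰_o`, Lemma 2.4, Cor. 2.5), §2.4. [cite: Rasmussen2010, §2.3]
* D. Bar-Natan, S. Morrison, *The Karoubi envelope and Lee's degeneration of Khovanov homology*,
  Algebr. Geom. Topol. 6 (2006) 1459–1469 (splitting along `𝐚/𝐛`-colourings).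
  [cite: BarNatanMorrison2006, §1]
* O. Viro, *Khovanov homology, its definitions and ramifications*, Fund. Math. 184 (2004), §5
  (enhanced states on Gauss diagrams). [cite: Viro2004, §5]
-/

open Function Set

noncomputable section

namespace Literature.Topology.FourManifolds

namespace LinkGaussDiagram

variable (L : LinkGaussDiagram)

/-! ## Checkerboard colourings (Gauss parity for link diagrams) -/

/-- A **checkerboard colouring** of the marked points of a link Gauss diagram: a colour
`c p : Bool` for the arc leaving each marked point `p`, changing at every marked point along the
traversal (`c (next p) = !c p`) and opposite at the two ends of every chord
(`c (underPos i) = !c (overPos i)`). For knot diagrams this is Gauss parity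
(`isCheckerboard_ofGaussDiagram`); for diagrams of links it is Rasmussen's "adjacent Seifert
circles carry different labels". Rasmussen (2010), Lemma 2.4, Cor. 2.5.
[cite: Rasmussen2010, §2.3] -/
structure IsCheckerboard (c : Fin (2 * L.n) → Bool) : Prop where
  /-- The colour changes at every marked point along the traversal. -/
  apply_next : ∀ p, c (L.next p) = !c p
  /-- The two ends of a chord have opposite colours. -/
  apply_underPos : ∀ i, c (L.underPos i) = !c (L.overPos i)

/-- Being a checkerboard colouring is decidable (finitely many Boolean equations). [folklore] -/
instance (c : Fin (2 * L.n) → Bool) : Decidable (L.IsCheckerboard c) :=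
  decidable_of_iff ((∀ p, c (L.next p) = !c p) ∧ ∀ i, c (L.underPos i) = !c (L.overPos i))
    ⟨fun h ↦ ⟨h.1, h.2⟩, fun h ↦ ⟨h.1, h.2⟩⟩

variable {L}

/-- The colour changes at every marked point, read backwards along the traversal. [folklore] -/
theorem IsCheckerboard.apply_symm {c : Fin (2 * L.n) → Bool} (hc : L.IsCheckerboard c)
    (p : Fin (2 * L.n)) : c (L.next.symm p) = !c p := by
  have h := hc.apply_next (L.next.symm p)
  rw [Equiv.apply_symm_apply] at h
  rw [h, Bool.not_not]

/-- The partner of a marked point has the opposite colour. [folklore] -/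
theorem IsCheckerboard.apply_partner {c : Fin (2 * L.n) → Bool} (hc : L.IsCheckerboard c)
    (p : Fin (2 * L.n)) : c (L.partner p) = !c p := by
  obtain ⟨i, rfl | rfl⟩ := L.exists_chord p
  · rw [partner_overPos, hc.apply_underPos]
  · rw [partner_underPos, hc.apply_underPos, Bool.not_not]

/-- A diagram without chords is checkerboard-coloured by the empty colouring. [folklore] -/
theorem isCheckerboard_of_n_eq_zero (h : L.n = 0) (c : Fin (2 * L.n) → Bool) :
    L.IsCheckerboard c :=
  ⟨fun p ↦ absurd p.isLt (by omega), fun i ↦ absurd i.isLt (by omega)⟩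

/-- Rotation by one on `Fin m`, `m` even, changes the parity of the value (including the
wrap-around `m - 1 ↦ 0`). [folklore] -/
theorem val_finRotate_mod_two {m : ℕ} (hm : Even m) (p : Fin m) :
    ((finRotate m p : Fin m) : ℕ) % 2 = (p.val + 1) % 2 := by
  cases m with
  | zero => exact p.elim0
  | succ m =>
    rw [coe_finRotate]
    split_ifs with h
    · subst h
      rw [Fin.val_last]
      obtain ⟨k, hk⟩ := hm
      omega
    · rfl

/-- **Gauss parity is a checkerboard colouring.** On the image of a knot diagram whose chords
satisfy Gauss parity (`overPos i ≢ underPos i (mod 2)`, the conclusion of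
`GaussDiagram.odd_overPos_add_underPos_of_dichotomy` for diagrams of knots), colouring the marked
point `p` by `[p even]` is a checkerboard colouring (`next = finRotate (2n)` alternates parity,
also at the wrap-around since `2n` is even). Rasmussen (2010), Lemma 2.4.
[cite: Rasmussen2010, §2.3] -/
theorem isCheckerboard_ofGaussDiagram (G : GaussDiagram)
    (hpar : ∀ i, (G.overPos i).val % 2 ≠ (G.underPos i).val % 2) :
    (ofGaussDiagram G).IsCheckerboard fun p ↦ decide (p.val % 2 = 0) where
  apply_next p := by
    have h := val_finRotate_mod_two (even_two_mul G.n) p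
    change decide (((finRotate (2 * G.n) p : Fin _) : ℕ) % 2 = 0) = !decide (p.val % 2 = 0)
    rw [h]
    by_cases hp : p.val % 2 = 0
    · rw [decide_eq_true hp, decide_eq_false (by omega)]; rfl
    · rw [decide_eq_false hp, decide_eq_true (by omega)]; rfl
  apply_underPos i := by
    have h := hpar i
    change decide ((G.underPos i).val % 2 = 0) = !decide ((G.overPos i).val % 2 = 0)
    by_cases hp : (G.overPos i).val % 2 = 0
    · rw [decide_eq_true hp, decide_eq_false (by omega)]; rfl
    · rw [decide_eq_false hp, decide_eq_true (by omega)]; rfl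

variable (L)

/-! ## The Seifert state (port of `KhResolutionsCircleProofs.seifertState`) -/

/-- The **Seifert state** (oriented resolution) of a link Gauss diagram: Seifert's smoothing at
every chord, i.e. the `0`-smoothing at the positive chords and the `1`-smoothing at the negative
ones, verbatim `GaussDiagram.seifertState`. Rasmussen (2010), §2.3; Bar-Natan (2002), §3.1.
[cite: Rasmussen2010, §2.3] -/
def seifertState : L.State := fun i ↦ !(L.sign i == 1)

/-- At every chord the Seifert state takes Seifert's smoothing. [folklore] -/
@[simp] theorem isSeifert_seifertState (i : Fin L.n) : L.isSeifert L.seifertState i = true := by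
  unfold isSeifert seifertState
  cases (L.sign i == 1) <;> rfl

/-- The weight of the Seifert state is the number `n₋` of negative chords. Bar-Natan (2002),
§3.1. [cite: BarNatan2002, §3.1] -/
theorem weight_seifertState : L.seifertState.weight = L.nMinus := by
  unfold State.weight nMinus seifertState
  congr 1
  apply Finset.filter_congr
  intro i _
  rcases Int.units_eq_one_or (L.sign i) with h | h <;> simp [h]

variable {L} in
/-- A state all of whose smoothings are Seifert's is the Seifert state. [folklore] -/
theorem eq_seifertState_of_forall {σ : L.State} (h : ∀ i, L.isSeifert σ i = true) :
    σ = L.seifertState := by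
  funext i
  have hi := h i
  unfold isSeifert at hi
  unfold seifertState
  revert hi
  cases σ i <;> cases (L.sign i == 1) <;> decide

/-- On the image of a knot diagram the Seifert state is the knot tower's (definitionally).
[folklore] -/
@[simp] theorem seifertState_ofGaussDiagram (G : GaussDiagram) :
    (ofGaussDiagram G).seifertState = G.seifertState := rfl

variable {L} in
/-- In the Seifert state only the Seifert gluings `arcIn p ~ arcOut (partner p)` occur.
[folklore] -/
theorem stateAdj_seifertState {a b : L.Arc} (h : L.stateAdj L.seifertState a b) :
    ∃ p, (a = L.arcIn p ∧ b = L.arcOut (L.partner p)) ∨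
      (b = L.arcIn p ∧ a = L.arcOut (L.partner p)) := by
  obtain ⟨-, p, ⟨-, hp⟩ | ⟨hS, -⟩⟩ := h
  · exact ⟨p, hp⟩
  · simp at hS

/-! ## Lee's canonical states -/

/-- **The Lee labelling** attached to a colouring `c` of the marked points, a global flip `t` and
free-circle labels `u`: the arc leaving `q` is labelled `bif c q then t else !t` (the knot tower's
`altLabel t q = if q even then t else !t` with `c = [· even]`), the free circle `j` is labelled
`u j`. Labels are read in Lee's basis `𝐚 ↔ false`, `𝐛 ↔ true`. Lee (2005), §4.4;
Rasmussen (2010), §2.3. [cite: Rasmussen2010, §2.3] -/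
def leeLabel (c : Fin (2 * L.n) → Bool) (t : Bool) (u : Fin L.free → Bool) : L.Arc → Bool :=
  Sum.elim (fun q ↦ bif c q then t else !t) u

/-- The Lee label of the arc leaving `p`. [folklore] -/
@[simp] theorem leeLabel_arcOut (c : Fin (2 * L.n) → Bool) (t : Bool) (u : Fin L.free → Bool)
    (p : Fin (2 * L.n)) : L.leeLabel c t u (L.arcOut p) = bif c p then t else !t := rfl

/-- The Lee label of a free circle. [folklore] -/
@[simp] theorem leeLabel_inr (c : Fin (2 * L.n) → Bool) (t : Bool) (u : Fin L.free → Bool)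
    (j : Fin L.free) : L.leeLabel c t u (.inr j) = u j := rfl

variable {L}

/-- For a checkerboard colouring, the Lee label of the arc entering `p` is opposite to that of
the arc leaving `p` (the knot tower's `IsAlternating`). Rasmussen (2010), Lemma 2.4.
[cite: Rasmussen2010, §2.3] -/
theorem IsCheckerboard.leeLabel_arcIn {c : Fin (2 * L.n) → Bool} (hc : L.IsCheckerboard c)
    (t : Bool) (u : Fin L.free → Bool) (p : Fin (2 * L.n)) :
    L.leeLabel c t u (L.arcIn p) = bif c p then !t else t := by
  change (bif c (L.next.symm p) then t else !t) = _
  rw [hc.apply_symm]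
  cases c p <;> rfl

/-- For a checkerboard colouring, the arc leaving the partner of `p` carries the label of the
arc entering `p`: the Seifert gluing is respected. [folklore] -/
theorem IsCheckerboard.leeLabel_arcOut_partner {c : Fin (2 * L.n) → Bool}
    (hc : L.IsCheckerboard c) (t : Bool) (u : Fin L.free → Bool) (p : Fin (2 * L.n)) :
    L.leeLabel c t u (L.arcOut (L.partner p)) = L.leeLabel c t u (L.arcIn p) := by
  rw [leeLabel_arcOut, hc.apply_partner, hc.leeLabel_arcIn]
  cases c p <;> rfl

variable (L) in
/-- **Lee's canonical state** of a link Gauss diagram attached to a checkerboard colouring `c`,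
a global flip `t` and free-circle labels `u`: the Seifert (oriented) resolution with the Lee
labelling `leeLabel c t u`, an enhanced state because the Seifert gluings
`arcIn p ~ arcOut (partner p)` are respected (`leeLabel_arcOut_partner`; port of
`compatAt_seifertState_of_isAlternating`). Lee (2005), §4.4.3; Rasmussen (2010), §2.3 (`𝔰_o`).
[cite: Rasmussen2010, §2.3] -/
def leeState {c : Fin (2 * L.n) → Bool} (hc : L.IsCheckerboard c) (t : Bool)
    (u : Fin L.free → Bool) : L.EnhancedState where
  state := L.seifertState
  label := L.leeLabel c t u
  label_eq a b hab := by
    rw [stateGraph, SimpleGraph.fromRel_adj] at hab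
    obtain ⟨-, h | h⟩ := hab
    · obtain ⟨p, ⟨rfl, rfl⟩ | ⟨rfl, rfl⟩⟩ := stateAdj_seifertState h
      · exact (hc.leeLabel_arcOut_partner t u p).symm
      · exact hc.leeLabel_arcOut_partner t u p
    · obtain ⟨p, ⟨rfl, rfl⟩ | ⟨rfl, rfl⟩⟩ := stateAdj_seifertState h
      · exact hc.leeLabel_arcOut_partner t u p
      · exact (hc.leeLabel_arcOut_partner t u p).symm

/-- The canonical states live over the Seifert state. [folklore] -/
@[simp] theorem leeState_state {c : Fin (2 * L.n) → Bool} (hc : L.IsCheckerboard c) (t : Bool)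
    (u : Fin L.free → Bool) : (L.leeState hc t u).state = L.seifertState := rfl

/-- The labelling of a canonical state is the Lee labelling. [folklore] -/
@[simp] theorem leeState_label {c : Fin (2 * L.n) → Bool} (hc : L.IsCheckerboard c) (t : Bool)
    (u : Fin L.free → Bool) : (L.leeState hc t u).label = L.leeLabel c t u := rfl

/-- **Alternation**: in a canonical state the two local strands at every marked point carry
different labels (the knot tower's `IsAlternating`, hence no chord is free). Rasmussen (2010),
Lemma 2.4, Cor. 2.5. [cite: Rasmussen2010, §2.3] -/
theorem leeState_label_arcOut {c : Fin (2 * L.n) → Bool} (hc : L.IsCheckerboard c) (t : Bool)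
    (u : Fin L.free → Bool) (p : Fin (2 * L.n)) :
    (L.leeState hc t u).label (L.arcOut p) = !(L.leeState hc t u).label (L.arcIn p) := by
  rw [leeState_label, leeLabel_arcOut, hc.leeLabel_arcIn]
  cases c p <;> cases t <;> rfl

/-- **Lee's canonical states have homological degree `0`** (the Seifert state has weight `n₋`).
Rasmussen (2010), §2.3. [cite: Rasmussen2010, §2.3] -/
theorem homDegree_leeState {c : Fin (2 * L.n) → Bool} (hc : L.IsCheckerboard c) (t : Bool)
    (u : Fin L.free → Bool) : homDegree (L.leeState hc t u) = 0 := by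
  simp [homDegree, weight_seifertState]

/-- An edge out of a state whose two local strands carry different labels of an enhanced state
is a merge (labels are constant on circles). [folklore] -/
theorem isMergeAt_of_label_ne {s : L.EnhancedState} {i : Fin L.n} (hi : s.state i = false)
    (hne : s.label (L.arcOut (L.overPos i)) ≠ s.label (L.arcIn (L.overPos i))) :
    L.IsMergeAt s.state i :=
  ⟨hi, fun h ↦ hne (s.label_eq_of_circleOf_eq h).symm⟩

/-- **Every edge out of the Seifert state is a merge** for a checkerboard-colourable diagram:
the local strands `arcIn (overPos i)`, `arcOut (overPos i)` carry different labels of a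
canonical state, so they lie on different Seifert circles. Rasmussen (2010), Lemma 2.4.
[cite: Rasmussen2010, §2.3] -/
theorem isMergeAt_seifertState {c : Fin (2 * L.n) → Bool} (hc : L.IsCheckerboard c)
    {i : Fin L.n} (hi : L.seifertState i = false) : L.IsMergeAt L.seifertState i :=
  isMergeAt_of_label_ne (s := L.leeState hc false fun _ ↦ false) hi
    (by rw [leeState_label_arcOut]; exact Bool.not_ne_self _)

/-! ## Correspondence with the knot tower's `leeState` -/

/-- The state of the pulled-back enhanced state. [folklore] -/
@[simp] theorem enhancedStateEquiv_symm_state (G : GaussDiagram) (hG : G.n ≠ 0)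
    (s : G.EnhancedState) : ((enhancedStateEquiv G hG).symm s).state = s.state := rfl

/-- The labels of the pulled-back enhanced state. [folklore] -/
@[simp] theorem enhancedStateEquiv_symm_label (G : GaussDiagram) (hG : G.n ≠ 0)
    (s : G.EnhancedState) (x : (ofGaussDiagram G).Arc) :
    ((enhancedStateEquiv G hG).symm s).label x = s.label (arcEquiv G hG x) := rfl

/-- **The canonical states correspond, with the same flip `t`.** On the image of a knot diagram
with Gauss parity, the canonical state of the colouring `[· even]` is carried by
`enhancedStateEquiv` to the knot tower's `G.leeState hpar t` (same Seifert state; the label of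
the arc leaving `p` is `t` iff `p` is even on both sides). Rasmussen (2010), §2.3.
[cite: Rasmussen2010, §2.3] -/
theorem enhancedStateEquiv_leeState (G : GaussDiagram) (hG : G.n ≠ 0)
    (hpar : ∀ i, (G.overPos i).val % 2 ≠ (G.underPos i).val % 2) (t : Bool) :
    enhancedStateEquiv G hG
        ((ofGaussDiagram G).leeState (isCheckerboard_ofGaussDiagram G hpar) t Fin.elim0) =
      G.leeState hpar t := by
  refine GaussDiagram.EnhancedState.ext' rfl (funext fun a ↦ ?_)
  change (bif decide (a.val % 2 = 0) then t else !t) = if a.val % 2 = 0 then t else !t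
  by_cases h : a.val % 2 = 0
  · rw [decide_eq_true h, if_pos h]; rfl
  · rw [decide_eq_false h, if_neg h]; rfl

/-! ## Flips: adjacency away from the flipped chord, and the monotonicity of a merge -/

variable (L)

/-- The four arcs at chord `i`: entering / leaving its over- and under-passage. [folklore] -/
def AtChord (i : Fin L.n) (e : L.Arc) : Prop :=
  e = L.arcIn (L.overPos i) ∨ e = L.arcOut (L.overPos i) ∨ e = L.arcIn (L.underPos i) ∨
    e = L.arcOut (L.underPos i)

/-- The arcs glued at an end of chord `i` are arcs at chord `i`. [folklore] -/
theorem atChord_of_chordOf_eq {p : Fin (2 * L.n)} {i : Fin L.n} (h : L.chordOf p = i) :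
    L.AtChord i (L.arcIn p) ∧ L.AtChord i (L.arcOut p) ∧ L.AtChord i (L.arcIn (L.partner p)) ∧
      L.AtChord i (L.arcOut (L.partner p)) := by
  rcases L.chordOf_spec p with hp | hp <;> rw [h] at hp <;> subst hp <;> simp [AtChord]

/-- **Gluings away from chord `i` do not see the smoothing at `i`.** If two states agree off
chord `i`, a reconnection of the first is a reconnection of the second unless both arcs are at
chord `i`. [folklore] -/
theorem stateAdj_of_eq_off {σ τ : L.State} {i : Fin L.n} (hστ : ∀ j, j ≠ i → τ j = σ j)
    {e e' : L.Arc} (h : L.stateAdj σ e e') :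
    L.stateAdj τ e e' ∨ (L.AtChord i e ∧ L.AtChord i e') := by
  obtain ⟨hne, p, hp⟩ := h
  by_cases hpi : L.chordOf p = i
  · obtain ⟨h1, h2, h3, h4⟩ := L.atChord_of_chordOf_eq hpi
    right
    rcases hp with ⟨-, ⟨rfl, rfl⟩ | ⟨rfl, rfl⟩⟩ | ⟨-, ⟨rfl, rfl⟩ | ⟨rfl, rfl⟩⟩
    · exact ⟨h1, h4⟩
    · exact ⟨h4, h1⟩
    · exact ⟨h1, h3⟩
    · exact ⟨h2, h4⟩
  · have hS : L.isSeifert τ (L.chordOf p) = L.isSeifert σ (L.chordOf p) := by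
      simp only [isSeifert, hστ _ hpi]
    exact Or.inl ⟨hne, p, by rw [hS]; exact hp⟩

/-- The same for adjacency in the state graphs. [folklore] -/
theorem adj_of_eq_off {σ τ : L.State} {i : Fin L.n} (hστ : ∀ j, j ≠ i → τ j = σ j)
    {e e' : L.Arc} (h : (L.stateGraph σ).Adj e e') :
    (L.stateGraph τ).Adj e e' ∨ (L.AtChord i e ∧ L.AtChord i e') := by
  rw [stateGraph, SimpleGraph.fromRel_adj] at h ⊢
  obtain ⟨hne, h | h⟩ := h
  · rcases L.stateAdj_of_eq_off hστ h with h' | ⟨h1, h2⟩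
    · exact Or.inl ⟨hne, Or.inl h'⟩
    · exact Or.inr ⟨h1, h2⟩
  · rcases L.stateAdj_of_eq_off hστ h with h' | ⟨h1, h2⟩
    · exact Or.inl ⟨hne, Or.inr h'⟩
    · exact Or.inr ⟨h2, h1⟩

/-- Glued arc-ends lie on the same state circle (`reachable_endArc_endGlue`). [folklore] -/
theorem circleOf_endArc_endGlue (τ : L.State) (x : Fin (2 * L.n) × Bool) :
    L.circleOf τ (L.endArc x) = L.circleOf τ (L.endArc (L.endGlue τ x)) :=
  SimpleGraph.ConnectedComponent.sound (L.reachable_endArc_endGlue τ x)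

/-- **In every state the four arcs at chord `i` lie on the circles of the two local strands**
`arcIn (overPos i)`, `arcOut (overPos i)` (the arcs at the under-passage are glued to them,
crosswise or straight according to the smoothing). [folklore] -/
theorem circleOf_eq_of_atChord (τ : L.State) {i : Fin L.n} {e : L.Arc} (he : L.AtChord i e) :
    L.circleOf τ e = L.circleOf τ (L.arcIn (L.overPos i)) ∨
      L.circleOf τ e = L.circleOf τ (L.arcOut (L.overPos i)) := by
  rcases he with rfl | rfl | rfl | rfl
  · exact Or.inl rfl
  · exact Or.inr rfl
  · have h := L.circleOf_endArc_endGlue τ (L.underPos i, false)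
    cases hS : L.isSeifert τ i
    · left; simpa [endArc, endGlue, hS] using h
    · right; simpa [endArc, endGlue, hS] using h
  · have h := L.circleOf_endArc_endGlue τ (L.underPos i, true)
    cases hS : L.isSeifert τ i
    · right; simpa [endArc, endGlue, hS] using h
    · left; simpa [endArc, endGlue, hS] using h

variable {L}

/-- After a merge at `i` the two local strands lie on one circle (a merge is not a split,
`IsMergeAt.not_isSplitAt`). Bar-Natan (2002), §3.1. [cite: BarNatan2002, §3.1] -/
theorem IsMergeAt.circleOf_update_arcIn {σ : L.State} {i : Fin L.n} (hm : L.IsMergeAt σ i) :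
    L.circleOf (update σ i true) (L.arcIn (L.overPos i)) =
      L.circleOf (update σ i true) (L.arcOut (L.overPos i)) := by
  by_contra h
  exact hm.not_isSplitAt ⟨hm.1, h⟩

/-- Along a merge edge, adjacent arcs of the source state lie on one circle of the target state.
[folklore] -/
theorem IsMergeAt.circleOf_update_eq_of_adj {σ : L.State} {i : Fin L.n} (hm : L.IsMergeAt σ i)
    {e e' : L.Arc} (h : (L.stateGraph σ).Adj e e') :
    L.circleOf (update σ i true) e = L.circleOf (update σ i true) e' := by
  rcases L.adj_of_eq_off (τ := update σ i true) (fun j hj ↦ update_of_ne hj _ _) h with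
    h' | ⟨he, he'⟩
  · exact SimpleGraph.ConnectedComponent.sound h'.reachable
  · have H : ∀ x, L.AtChord i x →
        L.circleOf (update σ i true) x = L.circleOf (update σ i true) (L.arcIn (L.overPos i)) :=
      fun x hx ↦ by
        rcases L.circleOf_eq_of_atChord (update σ i true) hx with h | h
        · exact h
        · exact h.trans hm.circleOf_update_arcIn.symm
    exact (H e he).trans (H e' he').symm

/-- **Monotonicity of a merge**: a circle of the source state of a merge edge is contained in a
circle of the target state. Bar-Natan (2002), §3.1 (a merge unites two circles and changes no
other). [cite: BarNatan2002, §3.1] -/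
theorem IsMergeAt.circleOf_update_eq {σ : L.State} {i : Fin L.n} (hm : L.IsMergeAt σ i)
    {e e' : L.Arc} (h : L.circleOf σ e = L.circleOf σ e') :
    L.circleOf (update σ i true) e = L.circleOf (update σ i true) e' := by
  obtain ⟨w⟩ := SimpleGraph.ConnectedComponent.exact h
  clear h
  induction w with
  | nil => rfl
  | cons hadj _ ih => exact (hm.circleOf_update_eq_of_adj hadj).trans ih

/-! ## Flipping the labels of the two merging circles -/

variable (L) in
/-- The labelling `lam` with its values reversed on the two circles of `σ` through the local
strands `arcIn (overPos i)`, `arcOut (overPos i)` (the two circles united by a merge at `i`).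
[folklore] -/
def flipLabel (σ : L.State) (i : Fin L.n) (lam : L.Arc → Bool) (e : L.Arc) : Bool :=
  if L.circleOf σ e = L.circleOf σ (L.arcIn (L.overPos i)) ∨
      L.circleOf σ e = L.circleOf σ (L.arcOut (L.overPos i)) then !lam e else lam e

/-- `flipLabel` of a labelling constant on circles is constant on circles. [folklore] -/
theorem flipLabel_congr {σ : L.State} (i : Fin L.n) {lam : L.Arc → Bool}
    (hlam : ∀ e e', L.circleOf σ e = L.circleOf σ e' → lam e = lam e') {e e' : L.Arc}
    (h : L.circleOf σ e = L.circleOf σ e') : L.flipLabel σ i lam e = L.flipLabel σ i lam e' := by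
  unfold flipLabel
  rw [h, hlam e e' h]

/-- **The flip involution** on enhanced states: reverse the labels on the two circles merging at
chord `i` if the edge at `i` is a merge, do nothing otherwise (so that no proof argument is
needed). [folklore] -/
def EnhancedState.flipAt (s : L.EnhancedState) (i : Fin L.n) : L.EnhancedState where
  state := s.state
  label := if L.IsMergeAt s.state i then L.flipLabel s.state i s.label else s.label
  label_eq e e' h := by
    have hc : L.circleOf s.state e = L.circleOf s.state e' :=
      SimpleGraph.ConnectedComponent.sound h.reachable
    split_ifs
    · exact flipLabel_congr i (fun _ _ h ↦ s.label_eq_of_circleOf_eq h) hc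
    · exact s.label_eq e e' h

/-- The flip does not change the state. [folklore] -/
@[simp] theorem EnhancedState.flipAt_state (s : L.EnhancedState) (i : Fin L.n) :
    (s.flipAt i).state = s.state := rfl

/-- At a merge, the flipped labels are `flipLabel`. [folklore] -/
theorem EnhancedState.flipAt_label {s : L.EnhancedState} {i : Fin L.n}
    (hm : L.IsMergeAt s.state i) : (s.flipAt i).label = L.flipLabel s.state i s.label :=
  if_pos hm

/-- The flip is an involution. [folklore] -/
theorem EnhancedState.flipAt_flipAt (s : L.EnhancedState) (i : Fin L.n) :
    (s.flipAt i).flipAt i = s := by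
  refine EnhancedState.ext' rfl ?_
  by_cases hm : L.IsMergeAt s.state i
  · have hm' : L.IsMergeAt (s.flipAt i).state i := hm
    rw [EnhancedState.flipAt_label hm', EnhancedState.flipAt_label hm]
    funext e
    change L.flipLabel s.state i (L.flipLabel s.state i s.label) e = s.label e
    unfold flipLabel
    split_ifs <;> simp
  · have hm' : ¬L.IsMergeAt (s.flipAt i).state i := hm
    have h1 : ((s.flipAt i).flipAt i).label = (s.flipAt i).label := if_neg hm'
    have h2 : (s.flipAt i).label = s.label := if_neg hm
    exact h1.trans h2

/-- The flip does not change the homological degree. [folklore] -/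
theorem EnhancedState.homDegree_flipAt (s : L.EnhancedState) (i : Fin L.n) :
    homDegree (s.flipAt i) = homDegree s := rfl

/-- At a merge, the flip reverses the label of the local strand `arcIn (overPos i)`.
[folklore] -/
theorem EnhancedState.flipAt_label_arcIn {s : L.EnhancedState} {i : Fin L.n}
    (hm : L.IsMergeAt s.state i) :
    (s.flipAt i).label (L.arcIn (L.overPos i)) = !s.label (L.arcIn (L.overPos i)) := by
  rw [EnhancedState.flipAt_label hm]
  exact if_pos (Or.inl rfl)

/-- At a merge, the flip reverses the label of the local strand `arcOut (overPos i)`.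
[folklore] -/
theorem EnhancedState.flipAt_label_arcOut {s : L.EnhancedState} {i : Fin L.n}
    (hm : L.IsMergeAt s.state i) :
    (s.flipAt i).label (L.arcOut (L.overPos i)) = !s.label (L.arcOut (L.overPos i)) := by
  rw [EnhancedState.flipAt_label hm]
  exact if_pos (Or.inr rfl)

/-- At a merge, the flip changes no label off the merged circle of the target state
(monotonicity `IsMergeAt.circleOf_update_eq`). [folklore] -/
theorem EnhancedState.flipAt_label_of_ne {s : L.EnhancedState} {i : Fin L.n}
    (hm : L.IsMergeAt s.state i) {x : L.Arc}
    (hx : L.circleOf (update s.state i true) x ≠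
      L.circleOf (update s.state i true) (L.arcIn (L.overPos i))) :
    (s.flipAt i).label x = s.label x := by
  rw [EnhancedState.flipAt_label hm]
  unfold flipLabel
  rw [if_neg]
  rintro (h | h)
  · exact hx (hm.circleOf_update_eq h)
  · exact hx ((hm.circleOf_update_eq h).trans hm.circleOf_update_arcIn.symm)

/-- Lee's multiplication table is invariant under reversing both inputs:
`m(1 ⊗ 1) = m(X ⊗ X) = 1`, `m(1 ⊗ X) = m(X ⊗ 1) = X` in `ℚ[X]/(X² - 1)`. Lee (2005), §4.
[cite: Lee2005, §4] -/
theorem mergeCoeff_lee_not_not (x y z : Bool) :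
    GaussDiagram.mergeCoeff ℚ 0 1 (!x) (!y) z = GaussDiagram.mergeCoeff ℚ 0 1 x y z := by
  cases x <;> cases y <;> cases z <;> simp [GaussDiagram.mergeCoeff]

/-- **The flip preserves Lee incidence numbers along the merge edge**: the agreement clause off
the merged circle is untouched (`flipAt_label_of_ne`) and the multiplication table entry is
invariant under reversing the labels of both merging circles (`mergeCoeff_lee_not_not`).
Lee (2005), §4; Viro (2004), §5.2. [cite: Lee2005, §4] -/
theorem incidence_flipAt {s s' : L.EnhancedState} {i : Fin L.n} (hm : L.IsMergeAt s.state i)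
    (hs' : s'.state = update s.state i true) :
    L.incidence ℚ 0 1 (s.flipAt i) s' = L.incidence ℚ 0 1 s s' := by
  have hm' : L.IsMergeAt (s.flipAt i).state i := hm
  rw [incidence_eq_mergeInc ℚ 0 1 hm' hs', incidence_eq_mergeInc ℚ 0 1 hm hs']
  change (edgeSign s.state i : ℚ) * _ = (edgeSign s.state i : ℚ) * _
  congr 1
  have hoff : ∀ x, L.circleOf s'.state x ≠ L.circleOf s'.state (L.arcIn (L.overPos i)) →
      (s.flipAt i).label x = s.label x := by
    intro x hx
    rw [hs'] at hx
    exact EnhancedState.flipAt_label_of_ne hm hx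
  unfold KhFace.mergeInc
  rw [EnhancedState.flipAt_label_arcIn hm, EnhancedState.flipAt_label_arcOut hm,
    mergeCoeff_lee_not_not]
  by_cases hc : ∀ x, L.circleOf s'.state x ≠ L.circleOf s'.state (L.arcIn (L.overPos i)) →
      s'.label x = s.label x
  · rw [if_pos hc, if_pos (fun x hx ↦ (hc x hx).trans (hoff x hx).symm)]
  · rw [if_neg hc, if_neg (fun hc' ↦ hc fun x hx ↦ (hc' x hx).trans (hoff x hx))]

/-! ## Lee monomials (port of `LeeRasmussenBasisProofs.pairCount`, `leeBasisMat`) -/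

variable (L)

/-- The number of circles of `σ` on which `λ = 1` (`false`) and `ℓ = 𝐛` (`true`): the exponent
of the sign of the enhanced state `(σ, λ)` in Lee's monomial `(σ, ℓ)` (`𝐛 = -1 + X`), verbatim
`GaussDiagram.pairCount`. Lee (2005), §4. [cite: Lee2005, §4] -/
def pairCount (σ : L.State) (lam ell : L.Arc → Bool) : ℕ :=
  (Finset.univ.filter fun C : L.StateCircle σ ↦
    ∃ a, L.circleOf σ a = C ∧ (!lam a && ell a) = true).card

/-- **The Lee monomial** of the enhanced state `s = (σ, ℓ)` in degree `k`: the chain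
`Σ_λ (-1)^{pairCount σ λ ℓ} · (σ, λ)`, the expansion of `⊗_C ℓ(C)` (`𝐚 = 1 + X`, `𝐛 = -1 + X` on
the circles `C` of `σ`) in the basis of enhanced states; the column of `s` in the knot tower's
`leeBasisMat k` (`leeMonomial_enhancedStateEquiv_symm`). For `s` a canonical state this is Lee's
canonical generator `𝔰_o`. Lee (2005), §4.4.3; Rasmussen (2010), §2.3. [cite: Lee2005, §4] -/
def leeMonomial (k : ℤ) (s : L.EnhancedState) : L.degStates k → ℚ := fun s₁ ↦
  if s₁.1.state = s.state then (-1 : ℚ) ^ L.pairCount s.state s₁.1.label s.label else 0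

variable {L}

/-- The Lee monomial of `s` is supported over the state of `s`. [folklore] -/
theorem leeMonomial_of_state_ne {k : ℤ} {s : L.EnhancedState} {s₁ : L.degStates k}
    (h : s₁.1.state ≠ s.state) : L.leeMonomial k s s₁ = 0 :=
  if_neg h

/-- The Lee monomial of `s` has coefficient `1` on `s` itself (no circle is labelled `(1, 𝐛)` by
`(ℓ, ℓ)`); in particular it is nonzero. [folklore] -/
theorem leeMonomial_self {k : ℤ} (s : L.degStates k) : L.leeMonomial k s.1 s = 1 := by
  rw [leeMonomial, if_pos rfl, pairCount]
  have h0 : (Finset.univ.filter fun C : L.StateCircle s.1.state ↦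
      ∃ a, L.circleOf s.1.state a = C ∧ (!s.1.label a && s.1.label a) = true) = ∅ :=
    Finset.filter_eq_empty_iff.2 fun C _ ⟨a, _, ha⟩ ↦ by cases h : s.1.label a <;> simp [h] at ha
  rw [h0, Finset.card_empty, pow_zero]

/-- The sign as a product over circles: `(-1)^{pairCount σ λ ℓ} = ∏_C (-1)^{[C labelled (1, 𝐛)]}`.
[folklore] -/
theorem neg_one_pow_pairCount (σ : L.State) (lam ell : L.Arc → Bool) :
    (-1 : ℚ) ^ L.pairCount σ lam ell = ∏ C : L.StateCircle σ,
      if ∃ a, L.circleOf σ a = C ∧ (!lam a && ell a) = true then (-1 : ℚ) else 1 := by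
  rw [pairCount, Finset.prod_ite, Finset.prod_const_one, mul_one, Finset.prod_const]

/-- **The flip reverses the sign of the Lee monomial.** If the two merging circles `C_a`, `C_b`
carry different labels `ℓ`, reversing `λ` on `C_a ∪ C_b` changes the number of circles labelled
`(1, 𝐛)` by one (on the `𝐛`-circle) — the combinatorial content of `m(𝐚 ⊗ 𝐛) = 0`. Lee (2005),
§4. [cite: Lee2005, §4] -/
theorem neg_one_pow_pairCount_flipLabel {σ : L.State} (i : Fin L.n)
    {lam ell : L.Arc → Bool} (hlam : ∀ e e', L.circleOf σ e = L.circleOf σ e' → lam e = lam e')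
    (hell : ∀ e e', L.circleOf σ e = L.circleOf σ e' → ell e = ell e')
    (hab : ell (L.arcOut (L.overPos i)) ≠ ell (L.arcIn (L.overPos i))) :
    (-1 : ℚ) ^ L.pairCount σ (L.flipLabel σ i lam) ell = -(-1 : ℚ) ^ L.pairCount σ lam ell := by
  classical
  set a := L.arcIn (L.overPos i)
  set b := L.arcOut (L.overPos i)
  -- the local strand whose circle is labelled `𝐛`
  obtain ⟨p₀, hp₀, hp₀C, hC⟩ : ∃ p₀ : L.Arc, ell p₀ = true ∧
      (L.circleOf σ p₀ = L.circleOf σ a ∨ L.circleOf σ p₀ = L.circleOf σ b) ∧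
      ∀ e, (L.circleOf σ e = L.circleOf σ a ∨ L.circleOf σ e = L.circleOf σ b) →
        L.circleOf σ e ≠ L.circleOf σ p₀ → ell e = false := by
    cases hea : ell a
    · refine ⟨b, by simpa [hea] using hab, Or.inr rfl, fun e he hne ↦ ?_⟩
      rcases he with he | he
      · rw [hell _ _ he, hea]
      · exact absurd he hne
    · refine ⟨a, hea, Or.inl rfl, fun e he hne ↦ ?_⟩
      rcases he with he | he
      · exact absurd he hne
      · rw [hell _ _ he]; simpa [hea] using hab
  have hε : (∏ C : L.StateCircle σ, if C = L.circleOf σ p₀ then (-1 : ℚ) else 1) = -1 :=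
    Fintype.prod_ite_eq' _ _
  rw [neg_one_pow_pairCount, neg_one_pow_pairCount, ← neg_one_mul (Finset.prod _ _), ← hε,
    ← Finset.prod_mul_distrib]
  refine Finset.prod_congr rfl fun C _ ↦ ?_
  obtain ⟨e₀, rfl⟩ : ∃ e₀, L.circleOf σ e₀ = C := Quot.exists_rep C
  have h1 : (∃ e, L.circleOf σ e = L.circleOf σ e₀ ∧ (!L.flipLabel σ i lam e && ell e) = true) ↔
      (!L.flipLabel σ i lam e₀ && ell e₀) = true :=
    ⟨fun ⟨e, he, hp⟩ ↦ by rwa [flipLabel_congr i hlam he, hell _ _ he] at hp,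
      fun h ↦ ⟨e₀, rfl, h⟩⟩
  have h2 : (∃ e, L.circleOf σ e = L.circleOf σ e₀ ∧ (!lam e && ell e) = true) ↔
      (!lam e₀ && ell e₀) = true :=
    ⟨fun ⟨e, he, hp⟩ ↦ by rwa [hlam _ _ he, hell _ _ he] at hp, fun h ↦ ⟨e₀, rfl, h⟩⟩
  simp only [h1, h2]
  unfold flipLabel
  by_cases he : L.circleOf σ e₀ = L.circleOf σ a ∨ L.circleOf σ e₀ = L.circleOf σ b
  · rw [if_pos he]
    by_cases he₀ : L.circleOf σ e₀ = L.circleOf σ p₀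
    · rw [if_pos he₀, hell _ _ he₀, hp₀]
      cases lam e₀ <;> norm_num
    · rw [if_neg he₀, hC e₀ he he₀]
      cases lam e₀ <;> norm_num
  · rw [if_neg he]
    have he₀ : L.circleOf σ e₀ ≠ L.circleOf σ p₀ := fun h ↦ he (h ▸ hp₀C)
    rw [if_neg he₀, one_mul]

/-- The flip reverses the sign of the Lee monomial of an enhanced state `s` whose local strands
at the merging chord carry different labels. [cite: Lee2005, §4] -/
theorem leeMonomial_flipAt {k : ℤ} {s : L.EnhancedState} {i : Fin L.n}
    (hab : s.label (L.arcOut (L.overPos i)) ≠ s.label (L.arcIn (L.overPos i)))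
    (hm : L.IsMergeAt s.state i) {s₁ : L.degStates k} (hσ : s₁.1.state = s.state) :
    L.leeMonomial k s ⟨s₁.1.flipAt i, (s₁.1.homDegree_flipAt i).trans s₁.2⟩ =
      -L.leeMonomial k s s₁ := by
  have hm₁ : L.IsMergeAt s₁.1.state i := by rw [hσ]; exact hm
  simp only [leeMonomial, EnhancedState.flipAt_state, hσ, if_true]
  rw [EnhancedState.flipAt_label hm₁, hσ]
  exact neg_one_pow_pairCount_flipLabel i
    (fun e e' h ↦ s₁.1.label_eq_of_circleOf_eq (by rw [hσ]; exact h))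
    (fun e e' h ↦ s.label_eq_of_circleOf_eq h) hab

/-! ## The cycle theorem -/

/-- **Lee's differential kills the Lee monomial of an enhanced state with no free chord.** If at
every `0`-smoothed chord `i` of `s = (σ, ℓ)` the local strands `arcIn (overPos i)`,
`arcOut (overPos i)` carry different labels, then `khovanovD ℚ 0 1 k k' (leeMonomial k s) = 0`:
every edge out of `σ` is a merge of two circles labelled `𝐚`, `𝐛` (`isMergeAt_of_label_ne`),
and the flip involution on the enhanced states over `σ` preserves each incidence number into a
fixed target (`incidence_flipAt`) while reversing the coefficient of the monomial
(`leeMonomial_flipAt`), so every matrix coefficient of `d (leeMonomial k s)` is a sum cancelling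
in pairs (`Finset.sum_involution`) — Lee's `m(𝐚 ⊗ 𝐛) = 0`. This is the link version of the knot
tower's `khovanovD_leeCoord_symm_single` (`D Π = 0`). Lee (2005), §4.4.3; Rasmussen (2010), §2.3.
[cite: Rasmussen2010, §2.3] -/
theorem khovanovD_leeMonomial_eq_zero (k k' : ℤ) (s : L.EnhancedState)
    (hs : ∀ i, s.state i = false →
      s.label (L.arcOut (L.overPos i)) ≠ s.label (L.arcIn (L.overPos i))) :
    L.khovanovD ℚ 0 1 k k' (L.leeMonomial k s) = 0 := by
  classical
  refine funext fun s' ↦ ?_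
  simp only [khovanovD, Matrix.toLin'_apply, Matrix.mulVec, dotProduct, Matrix.of_apply,
    Pi.zero_apply]
  by_cases hex : ∃ i, s.state i = false ∧ s'.1.state = update s.state i true
  · obtain ⟨i, hi, hs'⟩ := hex
    have hm : L.IsMergeAt s.state i := isMergeAt_of_label_ne hi (hs i hi)
    refine Finset.sum_involution
      (fun s₁ _ ↦ ⟨s₁.1.flipAt i, (s₁.1.homDegree_flipAt i).trans s₁.2⟩) (fun s₁ _ ↦ ?_)
      (fun s₁ _ hne heq ↦ ?_) (fun _ _ ↦ Finset.mem_univ _)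
      (fun s₁ _ ↦ Subtype.ext (EnhancedState.flipAt_flipAt _ _))
    · by_cases hσ : s₁.1.state = s.state
      · have hm₁ : L.IsMergeAt s₁.1.state i := by rw [hσ]; exact hm
        have hs'₁ : s'.1.state = update s₁.1.state i true := by rw [hσ]; exact hs'
        rw [incidence_flipAt hm₁ hs'₁, leeMonomial_flipAt (hs i hi) hm hσ, mul_neg,
          add_neg_cancel]
      · rw [leeMonomial_of_state_ne hσ, leeMonomial_of_state_ne
          (s₁ := ⟨s₁.1.flipAt i, (s₁.1.homDegree_flipAt i).trans s₁.2⟩) hσ, mul_zero, mul_zero,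
          add_zero]
    · have hσ : s₁.1.state = s.state := by
        by_contra h
        exact hne (by rw [leeMonomial_of_state_ne h, mul_zero])
      have hm₁ : L.IsMergeAt s₁.1.state i := by rw [hσ]; exact hm
      have h := congrArg (fun x : L.degStates k ↦ x.1.label (L.arcIn (L.overPos i))) heq
      simp only [EnhancedState.flipAt_label_arcIn hm₁] at h
      exact Bool.not_ne_self _ h
  · refine Finset.sum_eq_zero fun s₁ _ ↦ ?_
    by_cases hσ : s₁.1.state = s.state
    · rw [incidence_of_not_flip ℚ 0 1 (by rwa [hσ]), zero_mul]
    · rw [leeMonomial_of_state_ne hσ, mul_zero]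

/-- **Lee's canonical states are degree-zero Lee cycles**: the Lee monomial of
`leeState hc t u` lies in `leeCycles L = ker d₀` (alternation `leeState_label_arcOut` feeds
`khovanovD_leeMonomial_eq_zero`). The link version of the knot tower's
`leeCoord_symm_single_mem_leeCycles` (`not_free_leeState`). Lee (2005), §4.4.3; Rasmussen
(2010), §2.3 (`d 𝔰_o = 0`). [cite: Rasmussen2010, §2.3] -/
theorem leeMonomial_leeState_mem_leeCycles {c : Fin (2 * L.n) → Bool} (hc : L.IsCheckerboard c)
    (t : Bool) (u : Fin L.free → Bool) : L.leeMonomial 0 (L.leeState hc t u) ∈ L.leeCycles :=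
  LinearMap.mem_ker.2 (khovanovD_leeMonomial_eq_zero 0 (0 + 1) _
    fun i _ ↦ by rw [leeState_label_arcOut]; exact Bool.not_ne_self _)

/-- The canonical cycle is nonzero (coefficient `1` on the canonical state itself).
[cite: Rasmussen2010, §2.3] -/
theorem leeMonomial_leeState_ne_zero {c : Fin (2 * L.n) → Bool} (hc : L.IsCheckerboard c)
    (t : Bool) (u : Fin L.free → Bool) : L.leeMonomial 0 (L.leeState hc t u) ≠ 0 := fun h ↦ by
  have h1 := congrFun h ⟨L.leeState hc t u, homDegree_leeState hc t u⟩
  rw [leeMonomial_self ⟨L.leeState hc t u, homDegree_leeState hc t u⟩] at h1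
  exact one_ne_zero h1

/-! ## Correspondence of the Lee monomials with the knot tower's `leeBasis`, `leeCoord` -/

section Correspondence

variable (G : GaussDiagram) (hG : G.n ≠ 0)

/-- `pairCount` corresponds under `arcEquiv` (circles correspond, `stateGraphIso`). [folklore] -/
theorem pairCount_arcEquiv_symm (σ : G.State) (lam ell : (ofGaussDiagram G).Arc → Bool) :
    G.pairCount σ (fun a ↦ lam ((arcEquiv G hG).symm a)) (fun a ↦ ell ((arcEquiv G hG).symm a)) =
      (ofGaussDiagram G).pairCount σ lam ell := by
  unfold GaussDiagram.pairCount pairCount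
  symm
  refine Finset.card_equiv (stateGraphIso G hG σ).connectedComponentEquiv fun C ↦ ?_
  simp only [Finset.mem_filter, Finset.mem_univ, true_and]
  constructor
  · rintro ⟨a, rfl, ha⟩
    exact ⟨arcEquiv G hG a, by simp [circleOf, GaussDiagram.circleOf, stateGraphIso],
      by simpa using ha⟩
  · rintro ⟨a, ha, hl⟩
    refine ⟨(arcEquiv G hG).symm a, ?_, hl⟩
    apply (stateGraphIso G hG σ).connectedComponentEquiv.injective
    rw [← ha]
    simp [circleOf, GaussDiagram.circleOf, stateGraphIso]

/-- **The Lee monomial is the column of `leeBasisMat`.** For `G.n ≠ 0`, the Lee monomial of the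
pulled-back enhanced state `(enhancedStateEquiv G hG).symm s` of `ofGaussDiagram G`, relabelled
along `degStatesEquiv`, is the knot tower's `G.leeBasis k (Pi.single s 1)`. Lee (2005), §4.
[cite: Lee2005, §4] -/
theorem leeMonomial_enhancedStateEquiv_symm (k : ℤ) (s : G.degStates k)
    (s₁ : (ofGaussDiagram G).degStates k) :
    (ofGaussDiagram G).leeMonomial k ((enhancedStateEquiv G hG).symm s.1) s₁ =
      G.leeBasis k (Pi.single s 1) (degStatesEquiv G hG k s₁) := by
  rw [GaussDiagram.leeBasis_apply, Matrix.toLin'_apply, Matrix.mulVec_single_one]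
  change _ = if (enhancedStateEquiv G hG s₁.1).state = s.1.state then
    (-1 : ℚ) ^ G.pairCount s.1.state (enhancedStateEquiv G hG s₁.1).label s.1.label else 0
  have hl : s.1.label = fun a ↦ ((enhancedStateEquiv G hG).symm s.1).label
      ((arcEquiv G hG).symm a) := funext fun a ↦ by simp
  simp only [leeMonomial, enhancedStateEquiv_state, enhancedStateEquiv_symm_state]
  split_ifs with h₁ h₂ h₃
  · rw [hl]
    exact congrArg _ (pairCount_arcEquiv_symm G hG _ _ _).symm
  · exact absurd h₁ h₂
  · exact absurd h₃ h₁
  · rfl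

/-- **The Lee monomial is `2 ^ #circles` times the knot tower's canonical generator**
`(G.leeCoord k).symm (Pi.single s 1)` of `RasmussenSliceCanonicalProofs` (`Mᵀ M = 2^{#circles}`,
`leeBasisMat_transpose_mul`), transported along `LinearEquiv.funCongrLeft ℚ ℚ (degStatesEquiv)`
as in `khovanovD_comp_funCongrLeft`. Lee (2005), §4.4.2. [cite: Lee2005, §4] -/
theorem funCongrLeft_leeCoord_symm_single (k : ℤ) (s : G.degStates k) :
    LinearEquiv.funCongrLeft ℚ ℚ (degStatesEquiv G hG k)
        ((2 : ℚ) ^ G.circleCount s.1.state • (G.leeCoord k).symm (Pi.single s 1)) =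
      (ofGaussDiagram G).leeMonomial k ((enhancedStateEquiv G hG).symm s.1) := by
  have key : (2 : ℚ) ^ G.circleCount s.1.state • (G.leeCoord k).symm (Pi.single s 1) =
      G.leeBasis k (Pi.single s 1) := by
    apply (G.leeCoord k).injective
    rw [map_smul, LinearEquiv.apply_symm_apply, GaussDiagram.leeCoord_apply,
      GaussDiagram.leeBasis_apply, ← Matrix.toLin'_mul_apply,
      GaussDiagram.leeBasisMat_transpose_mul, Matrix.toLin'_apply]
    ext u
    rw [Matrix.mulVec_diagonal, Pi.smul_apply, smul_eq_mul]
    by_cases hu : u = s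
    · subst hu; rfl
    · rw [Pi.single_eq_of_ne hu, mul_zero, mul_zero]
  rw [key]
  refine funext fun s₁ ↦ ?_
  rw [LinearEquiv.funCongrLeft_apply, LinearMap.funLeft_apply,
    leeMonomial_enhancedStateEquiv_symm]

/-- **The canonical cycles correspond.** On the image of a knot diagram with Gauss parity, the
Lee monomial of the canonical state `leeState _ t Fin.elim0` is the transport along
`degStatesEquiv` of `2 ^ #circles • (G.leeCoord 0).symm (Pi.single ⟨G.leeState hpar t, _⟩ 1)`,
the knot tower's canonical cycle of `leeCoord_symm_single_mem_leeCycles` /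
`not_free_leeState` (`enhancedStateEquiv_leeState`, `funCongrLeft_leeCoord_symm_single`).
Rasmussen (2010), §2.3. [cite: Rasmussen2010, §2.3] -/
theorem funCongrLeft_leeCoord_symm_single_leeState
    (hpar : ∀ i, (G.overPos i).val % 2 ≠ (G.underPos i).val % 2) (t : Bool) :
    LinearEquiv.funCongrLeft ℚ ℚ (degStatesEquiv G hG 0)
        ((2 : ℚ) ^ G.circleCount G.seifertState • (G.leeCoord 0).symm
          (Pi.single ⟨G.leeState hpar t, GaussDiagram.homDegree_leeState hpar t⟩ 1)) =
      (ofGaussDiagram G).leeMonomial 0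
        ((ofGaussDiagram G).leeState (isCheckerboard_ofGaussDiagram G hpar) t Fin.elim0) := by
  refine (funCongrLeft_leeCoord_symm_single G hG 0
    ⟨G.leeState hpar t, GaussDiagram.homDegree_leeState hpar t⟩).trans ?_
  congr 1
  apply (enhancedStateEquiv G hG).injective
  rw [Equiv.apply_symm_apply, enhancedStateEquiv_leeState]

end Correspondence

/-! ## Sanity: the unlinks `unknots k` and the Hopf link -/

/-- Every colouring of `unknots k` (there is no marked point) is a checkerboard colouring.
[folklore] -/
theorem isCheckerboard_unknots (k : ℕ) (c : Fin (2 * (unknots k).n) → Bool) :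
    (unknots k).IsCheckerboard c :=
  isCheckerboard_of_n_eq_zero rfl c

/-- **Sanity: on the unlink every labelling of the free circles is a canonical state**, and these
are all the `2 ^ k` enhanced states (`card_enhancedState_unknots`): `u ↦ leeState _ t u` is a
bijection. Rasmussen (2010), §2.3 (unlinks). [cite: Rasmussen2010, §2.3] -/
theorem leeState_unknots_bijective (k : ℕ) {c : Fin (2 * (unknots k).n) → Bool}
    (hc : (unknots k).IsCheckerboard c) (t : Bool) :
    Bijective fun u ↦ (unknots k).leeState hc t u := by
  refine ⟨fun u v h ↦ funext fun j ↦ congrArg (fun s ↦ s.label (.inr j)) h, fun s ↦ ?_⟩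
  refine ⟨fun j ↦ s.label (.inr j), EnhancedState.ext' (funext fun i ↦ isEmptyElim i)
    (funext fun a ↦ ?_)⟩
  rcases a with q | j
  · exact absurd q.isLt (Nat.not_lt_zero _)
  · rfl

/-- On the unlink all `2 ^ k` Lee monomials of the canonical states are degree-zero Lee cycles
(an instance of `leeMonomial_leeState_mem_leeCycles`; here `d = 0`). [cite: Rasmussen2010, §2.3] -/
theorem leeMonomial_mem_leeCycles_unknots (k : ℕ) (t : Bool) (u : Fin k → Bool) :
    (unknots k).leeMonomial 0 ((unknots k).leeState (isCheckerboard_unknots k fun _ ↦ t) t u) ∈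
      (unknots k).leeCycles :=
  leeMonomial_leeState_mem_leeCycles (L := unknots k) (isCheckerboard_unknots k fun _ ↦ t) t u

/-- **Sanity (`decide`).** The positive Hopf link diagram `hopfLink` (components `{0, 1}`,
`{2, 3}`, chords `0 ↦ (0, 2)`, `1 ↦ (3, 1)`) is checkerboard-coloured by `0, 3 ↦ true`,
`1, 2 ↦ false`. [folklore] -/
theorem isCheckerboard_hopfLink : hopfLink.IsCheckerboard ![true, false, false, true] := by
  decide

/-- The Hopf link has two canonical Lee cycles in degree zero over its Seifert state
(`t = false, true`; the other two of Lee's four generators live over the all-`1` state, the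
oriented resolution of the Hopf link with one component reversed). Lee (2005), §4.4.
[cite: Lee2005, §4] -/
theorem leeMonomial_mem_leeCycles_hopfLink (t : Bool) :
    hopfLink.leeMonomial 0 (hopfLink.leeState isCheckerboard_hopfLink t Fin.elim0) ∈
      hopfLink.leeCycles :=
  leeMonomial_leeState_mem_leeCycles _ t _

end LinkGaussDiagram

end Literature.Topology.FourManifolds

end
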